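import Summits.QuantumFields.YangMills.Theorems.BalabanUVNodesPortU8TwoVolumeRowB

/-!
# PORT PT-B (U8), g3 file 14 — THE SANDWICH FOR 27931 v11-G₄'s GLOBAL (R4ᴰ), PART C: ★★ the per-bond four clauses for `E := Hr_{K+1}(y′) ∘ lift − Hr_K(y)` on the bonds of an
# off-wrap domain (NEAR: Tok-182 ⊕ Tok-cmpU-cap ⊕ ✓window transport; FAR: ‴ on both members) and ★★★ the GLOBAL two-volume row `rowR4D_L_sandwich` for `recordGkL`
# (`≤ C₄·e^{−(δ₉∕4)ρ∕2}·e^{−(δ₉∕8)·dist(y,X)}`) — the `hR4`-row of ✓`portPieceLocalityU8_v10_of`, now PROVED from v11-G₄'s displayed tokens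

Cell `ym-nodeO-ideate` ∕ `ym-balaban-port`, porter `ymgap-nodeO-port-PTB-1` (gen 3), item **stmt-QuantumFields-27931** `BalabanUVNodes.PortPieceLocalityU8` (text v11-G₄ `bca3cb0d9af367ce`).
`--supports stmt-QuantumFields-27931` (helper).  [I] = [Balaban1987RG1], [15] = [Balaban1985Variational], [B6] = [Balaban1984PropagatorsII].
HONEST FRAMING.  The sandwich estimate under the three DISPLAYED tokens of v11-G₄ (asserted by nobody); nothing of Bałaban's analysis asserted∕ported∕discharged; 27931 OPEN · SIGNED v11-G₄ ·
close HOLD until the slot word; K0⁷ OPEN; NODE O 0∕1; COUNT 8∕28 · K 1∕4 UNMOVED; finite `𝕋⁴_{L^K}` at fixed ε — NOT continuum ∕ OS ∕ Clay; **the Yang–Mills mass gap (Clay) is NOT proved.**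
-/

noncomputable section

open scoped BigOperators Matrix.Norms.L2Operator
open Complex (I)

namespace Summit.QuantumFields.YangMills.Theorems.PortU8

open Literature.MathematicalPhysics.QuantumFieldTheory.Balaban1983to89
open Literature.MathematicalPhysics.QuantumFieldTheory.Balaban1983to89.Node00
open Literature.MathematicalPhysics.QuantumFieldTheory.Balaban1983to89.T4Continuum (T4Family)
open Literature.MathematicalPhysics.QuantumFieldTheory.Balaban1983to89.B14.Eq213MaximalDomains (side)
open Summit.QuantumFields.YangMills.Theorems.K0RecordFormatNames

variable (F : T4Family)

section Sandwich

variable {F}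
variable (a₀ ε₂₉ : ℝ) {Mc k K : ℕ}

/-- The exponential bookkeeping of the NEAR bonds: `t ≤ ρ`, `R0 − R3 ≥ ρ∕4 − 2`. [folklore] -/
theorem exp_near_le {δ ρ t d Mc : ℝ} (hδ : 0 ≤ δ) (hMc : 0 ≤ Mc) (ht : t ≤ ρ) (hd : ρ / 4 - 2 ≤ d) :
    Real.exp (-(δ * d)) ≤ Real.exp (δ * (2 * Mc + 2)) * Real.exp (-(δ / 8) * ρ) * Real.exp (-(δ / 8 * t)) := by
  rw [← Real.exp_add, ← Real.exp_add]
  apply Real.exp_le_exp.2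
  nlinarith

/-- The exponential bookkeeping of the FAR bonds: `t ≥ ρ∕4 − 2Mc − 1`. [folklore] -/
theorem exp_far_le {δ ρ t Mc : ℝ} (hδ : 0 ≤ δ) (hMc : 0 ≤ Mc) (hρ : 0 ≤ ρ) (ht : ρ / 4 - 2 * Mc - 1 ≤ t) :
    Real.exp (-(δ * t)) ≤ Real.exp (δ * (2 * Mc + 2)) * Real.exp (-(δ / 8) * ρ) * Real.exp (-(δ / 8 * t)) := by
  rw [← Real.exp_add, ← Real.exp_add]
  apply Real.exp_le_exp.2
  nlinarith
set_option maxHeartbeats 400000 in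
/-- ★★ **THE PER-BOND FOUR CLAUSES FOR THE TWO-VOLUME DIFFERENCE `E := Hr_{K+1}(y′) ∘ lift − Hr_K(y)`** on every bond of a domain `X ∉ recordWrapCtr` (tiled range), at the fill, for the
N-slot label `y = recordE K μ z` (`2|z| < ρ`), from: ‴ on both members (`h3`, `h3'`), Tok-182 on both members (`h182`, `h182'`), Tok-cmpU-cap on both members at the sandwich radii
(`hcmp`, `hcmp'`) — all DISPLAYED hypotheses of v11-G₄ —, and the window transport lemma (✓file 9).  Rate: `Ĉ·η^j·e^{−(δ₉∕8)·tdist(coarse β₋, y₂)}`,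
`Ĉ = 2C·e^{δ₉(2Mc+2)}·e^{−(δ₉∕8)ρ}`. [cite: Balaban1987RG1, (1.21) p.264, p.290 L17–20, (4.35) p.290; Balaban1985Variational, (182) p.307, (190) p.308] -/
theorem sandwich_clauses (hMc : McGuard F Mc) (hK : recordK₀ F Mc k ≤ K) (a : (thetaFill F a₀ ε₂₉).ιβ) (μ : Fin 4) (z : Fin 4 → ℤ)
    (hz : ∀ l, 2 * |z l| < (recordRNat F Mc k K : ℤ)) {X : (recordDomSys F Mc k K).Dom} (hX : X ∉ recordWrapCtr F Mc k K)
    {C δ₉ : ℝ} (hC : 0 ≤ C) (hδ : 0 < δ₉)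
    (h3 : letI Hr := recordHr F (thetaFill F a₀ ε₂₉) k K a (recordE F k K μ z);
      ∀ b : PBond (F.P K) 0,
        ‖Hr b‖ ≤ C * (F.P K).eta (k + 1) * Real.exp (-(δ₉ * (Site.tdist (coarsenTo (k + 1) b.src) (recordE F k K μ z).2 : ℝ))) ∧
        (∀ ν : Fin (F.P K).d, ‖Hr ⟨b.src.shift ν, b.dir⟩ - Hr b‖ ≤ C * (F.P K).eta (k + 1) ^ 2 * Real.exp (-(δ₉ * (Site.tdist (coarsenTo (k + 1) b.src) (recordE F k K μ z).2 : ℝ)))) ∧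
        ‖∑ ν : Fin (F.P K).d, (Hr ⟨b.src.shift ν, b.dir⟩ - (2 : ℂ) • Hr b + Hr ⟨b.src.unshift ν, b.dir⟩)‖ ≤
          C * (F.P K).eta (k + 1) ^ 3 * Real.exp (-(δ₉ * (Site.tdist (coarsenTo (k + 1) b.src) (recordE F k K μ z).2 : ℝ))) ∧
        ‖∑ ν : Fin (F.P K).d, ((Hr ⟨b.src, b.dir⟩ + Hr ⟨(b.src).shift b.dir, ν⟩ - Hr ⟨(b.src).shift ν, b.dir⟩ - Hr ⟨b.src, ν⟩) -
          (Hr ⟨b.src.unshift ν, b.dir⟩ + Hr ⟨(b.src.unshift ν).shift b.dir, ν⟩ - Hr ⟨(b.src.unshift ν).shift ν, b.dir⟩ - Hr ⟨b.src.unshift ν, ν⟩))‖ ≤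
          C * (F.P K).eta (k + 1) ^ 3 * Real.exp (-(δ₉ * (Site.tdist (coarsenTo (k + 1) b.src) (recordE F k K μ z).2 : ℝ))))
    (h3' : letI Hr := recordHr F (thetaFill F a₀ ε₂₉) k (K + 1) a (recordE F k (K + 1) μ z);
      ∀ b : PBond (F.P (K + 1)) 0,
        ‖Hr b‖ ≤ C * (F.P (K + 1)).eta (k + 1) * Real.exp (-(δ₉ * (Site.tdist (coarsenTo (k + 1) b.src) (recordE F k (K + 1) μ z).2 : ℝ))) ∧
        (∀ ν : Fin (F.P (K + 1)).d, ‖Hr ⟨b.src.shift ν, b.dir⟩ - Hr b‖ ≤ C * (F.P (K + 1)).eta (k + 1) ^ 2 * Real.exp (-(δ₉ * (Site.tdist (coarsenTo (k + 1) b.src) (recordE F k (K + 1) μ z).2 : ℝ)))) ∧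
        ‖∑ ν : Fin (F.P (K + 1)).d, (Hr ⟨b.src.shift ν, b.dir⟩ - (2 : ℂ) • Hr b + Hr ⟨b.src.unshift ν, b.dir⟩)‖ ≤
          C * (F.P (K + 1)).eta (k + 1) ^ 3 * Real.exp (-(δ₉ * (Site.tdist (coarsenTo (k + 1) b.src) (recordE F k (K + 1) μ z).2 : ℝ))) ∧
        ‖∑ ν : Fin (F.P (K + 1)).d, ((Hr ⟨b.src, b.dir⟩ + Hr ⟨(b.src).shift b.dir, ν⟩ - Hr ⟨(b.src).shift ν, b.dir⟩ - Hr ⟨b.src, ν⟩) -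
          (Hr ⟨b.src.unshift ν, b.dir⟩ + Hr ⟨(b.src.unshift ν).shift b.dir, ν⟩ - Hr ⟨(b.src.unshift ν).shift ν, b.dir⟩ - Hr ⟨b.src.unshift ν, ν⟩))‖ ≤
          C * (F.P (K + 1)).eta (k + 1) ^ 3 * Real.exp (-(δ₉ * (Site.tdist (coarsenTo (k + 1) b.src) (recordE F k (K + 1) μ z).2 : ℝ))))
    (h182 : ∀ b : PBond (F.P K) 0, recordHr F (thetaFill F a₀ ε₂₉) k K a (recordE F k K μ z) b = recordHrLocξ F (thetaFill F a₀ ε₂₉) k K Finset.univ a (recordE F k K μ z) b)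
    (h182' : ∀ b : PBond (F.P (K + 1)) 0, recordHr F (thetaFill F a₀ ε₂₉) k (K + 1) a (recordE F k (K + 1) μ z) b =
      recordHrLocξ F (thetaFill F a₀ ε₂₉) k (K + 1) Finset.univ a (recordE F k (K + 1) μ z) b)
    (hcmp : ∀ R3 R0 : ℕ, R3 + nestRadius Mc 1 ≤ R0 → 2 * (R0 + 1) < (F.P K).sitesPerDir (k + 1) → ∀ z₀ : Fin 4 → ℤ, (recordE F k K μ z).2 ∈ recordWindow F k K R3 z₀ →
      letI Hd : PBond (F.P K) 0 → Fin 2 → Fin 2 → ℂ := fun b' => recordHrLocξ F (thetaFill F a₀ ε₂₉) k K Finset.univ a (recordE F k K μ z) b' -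
        recordHrLocξ F (thetaFill F a₀ ε₂₉) k K (recordWindow F k K R0 z₀) a (recordE F k K μ z) b';
      ∀ b : PBond (F.P K) 0, coarsenTo (k + 1) b.src ∈ recordWindow F k K R3 z₀ →
        ‖Hd b‖ ≤ C * (F.P K).eta (k + 1) * Real.exp (-(δ₉ * ((R0 : ℝ) - (R3 : ℝ)))) ∧
        (∀ ν : Fin (F.P K).d, ‖Hd ⟨b.src.shift ν, b.dir⟩ - Hd b‖ ≤ C * (F.P K).eta (k + 1) ^ 2 * Real.exp (-(δ₉ * ((R0 : ℝ) - (R3 : ℝ))))) ∧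
        ‖∑ ν : Fin (F.P K).d, (Hd ⟨b.src.shift ν, b.dir⟩ - (2 : ℂ) • Hd b + Hd ⟨b.src.unshift ν, b.dir⟩)‖ ≤ C * (F.P K).eta (k + 1) ^ 3 * Real.exp (-(δ₉ * ((R0 : ℝ) - (R3 : ℝ)))) ∧
        ‖∑ ν : Fin (F.P K).d, ((Hd ⟨b.src, b.dir⟩ + Hd ⟨(b.src).shift b.dir, ν⟩ - Hd ⟨(b.src).shift ν, b.dir⟩ - Hd ⟨b.src, ν⟩) -
          (Hd ⟨b.src.unshift ν, b.dir⟩ + Hd ⟨(b.src.unshift ν).shift b.dir, ν⟩ - Hd ⟨(b.src.unshift ν).shift ν, b.dir⟩ - Hd ⟨b.src.unshift ν, ν⟩))‖ ≤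
          C * (F.P K).eta (k + 1) ^ 3 * Real.exp (-(δ₉ * ((R0 : ℝ) - (R3 : ℝ)))))
    (hcmp' : ∀ R3 R0 : ℕ, R3 + nestRadius Mc 1 ≤ R0 → 2 * (R0 + 1) < (F.P (K + 1)).sitesPerDir (k + 1) → ∀ z₀ : Fin 4 → ℤ, (recordE F k (K + 1) μ z).2 ∈ recordWindow F k (K + 1) R3 z₀ →
      letI Hd : PBond (F.P (K + 1)) 0 → Fin 2 → Fin 2 → ℂ := fun b' => recordHrLocξ F (thetaFill F a₀ ε₂₉) k (K + 1) Finset.univ a (recordE F k (K + 1) μ z) b' -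
        recordHrLocξ F (thetaFill F a₀ ε₂₉) k (K + 1) (recordWindow F k (K + 1) R0 z₀) a (recordE F k (K + 1) μ z) b';
      ∀ b : PBond (F.P (K + 1)) 0, coarsenTo (k + 1) b.src ∈ recordWindow F k (K + 1) R3 z₀ →
        ‖Hd b‖ ≤ C * (F.P (K + 1)).eta (k + 1) * Real.exp (-(δ₉ * ((R0 : ℝ) - (R3 : ℝ)))) ∧
        (∀ ν : Fin (F.P (K + 1)).d, ‖Hd ⟨b.src.shift ν, b.dir⟩ - Hd b‖ ≤ C * (F.P (K + 1)).eta (k + 1) ^ 2 * Real.exp (-(δ₉ * ((R0 : ℝ) - (R3 : ℝ))))) ∧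
        ‖∑ ν : Fin (F.P (K + 1)).d, (Hd ⟨b.src.shift ν, b.dir⟩ - (2 : ℂ) • Hd b + Hd ⟨b.src.unshift ν, b.dir⟩)‖ ≤ C * (F.P (K + 1)).eta (k + 1) ^ 3 * Real.exp (-(δ₉ * ((R0 : ℝ) - (R3 : ℝ)))) ∧
        ‖∑ ν : Fin (F.P (K + 1)).d, ((Hd ⟨b.src, b.dir⟩ + Hd ⟨(b.src).shift b.dir, ν⟩ - Hd ⟨(b.src).shift ν, b.dir⟩ - Hd ⟨b.src, ν⟩) -
          (Hd ⟨b.src.unshift ν, b.dir⟩ + Hd ⟨(b.src.unshift ν).shift b.dir, ν⟩ - Hd ⟨(b.src.unshift ν).shift ν, b.dir⟩ - Hd ⟨b.src.unshift ν, ν⟩))‖ ≤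
          C * (F.P (K + 1)).eta (k + 1) ^ 3 * Real.exp (-(δ₉ * ((R0 : ℝ) - (R3 : ℝ)))))
    {β : PBond (F.P K) 0} (hβ : β ∈ domBonds F Mc k K X) :
    letI E : PBond (F.P K) 0 → Fin 2 → Fin 2 → ℂ := fun b' => recordHr F (thetaFill F a₀ ε₂₉) k (K + 1) a (recordE F k (K + 1) μ z) (liftBondCtr F K 0 b') -
      recordHr F (thetaFill F a₀ ε₂₉) k K a (recordE F k K μ z) b'
    letI Ch : ℝ := 2 * C * Real.exp (δ₉ * (2 * Mc + 2)) * Real.exp (-(δ₉ / 8) * recordRNat F Mc k K)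
    letI e : ℝ := Real.exp (-(δ₉ / 8 * (Site.tdist (coarsenTo (k + 1) β.src) (recordE F k K μ z).2 : ℝ)))
    ‖E ⟨β.src, β.dir⟩‖ ≤ Ch * (F.P K).eta (k + 1) * e ∧
    (∀ ν : Fin (F.P K).d, ‖E ⟨β.src.shift ν, β.dir⟩ - E ⟨β.src, β.dir⟩‖ ≤ Ch * (F.P K).eta (k + 1) ^ 2 * e) ∧
    ‖∑ ν : Fin (F.P K).d, (E ⟨β.src.shift ν, β.dir⟩ - (2 : ℂ) • E ⟨β.src, β.dir⟩ + E ⟨β.src.unshift ν, β.dir⟩)‖ ≤ Ch * (F.P K).eta (k + 1) ^ 3 * e ∧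
    ‖∑ ν : Fin (F.P K).d, ((E ⟨β.src, β.dir⟩ + E ⟨β.src.shift β.dir, ν⟩ - E ⟨β.src.shift ν, β.dir⟩ - E ⟨β.src, ν⟩) -
      (E ⟨β.src.unshift ν, β.dir⟩ + E ⟨(β.src.unshift ν).shift β.dir, ν⟩ - E ⟨(β.src.unshift ν).shift ν, β.dir⟩ - E ⟨β.src.unshift ν, ν⟩))‖ ≤ Ch * (F.P K).eta (k + 1) ^ 3 * e := by
  have hk : k + 1 ≤ F.m + K := by unfold recordK₀ at hK; omega
  obtain ⟨hsh, hun, hus⟩ := stencil_commute_of_mem_domBonds hMc hK hX hβ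
  obtain ⟨hR30, hcap, hcap', hdiff, hR3lo, h4R3⟩ := sandwich_radii hMc hK
  have hnw : NoWrapAt F k K (recordRNat F Mc k K / 2 - 1) (-z) := noWrapAt_sandwich hMc hK hz
  have hl1 : ((recordE F k (K + 1) μ z).1 : Fin 4) = (recordE F k K μ z).1 := Fin.ext rfl
  have hl2 : (recordE F k (K + 1) μ z).2 = liftSiteCtr F K (k + 1) (recordE F k K μ z).2 := recordE_succ_snd_eq_lift F hMc hK μ z hz
  have hy2 : (recordE F k K μ z).2 = siteOfInt F K (k + 1) (-z) := rfl
  have heta : (F.P (K + 1)).eta (k + 1) = (F.P K).eta (k + 1) := rfl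
  have hη0 : 0 < (F.P K).eta (k + 1) := by unfold Params.eta; exact pow_pos (inv_pos.2 (F.P K).cast_L_pos) _
  have hη2 := pow_pos hη0 2
  have hη3 := pow_pos hη0 3
  have hMc0 : (0 : ℝ) ≤ Mc := Nat.cast_nonneg _
  have hρ0 : (0 : ℝ) ≤ (recordRNat F Mc k K : ℝ) := Nat.cast_nonneg _
  -- coarse site of the lifted bond = lift of the coarse site; torus distances do not decrease
  have hcoarse : coarsenTo (k + 1) (liftBondCtr F K 0 β).src = liftSiteCtr F K (k + 1) (coarsenTo (k + 1) β.src) :=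
    coarsenTo_liftSiteCtr_of_mem_domSites hMc hK hX hβ.1
  have htt : (Site.tdist (coarsenTo (k + 1) β.src) (recordE F k K μ z).2 : ℝ) ≤ (Site.tdist (coarsenTo (k + 1) (liftBondCtr F K 0 β).src) (recordE F k (K + 1) μ z).2 : ℝ) := by
    rw [hcoarse, hl2]; exact_mod_cast tdist_le_tdist_liftSiteCtr F K (k + 1) hk _ _
  by_cases hnear : coarsenTo (k + 1) β.src ∈ recordWindow F k K (recordRNat F Mc k K / 4 - 2 * Mc) (-z)
  · -- NEAR: `E = Hd′ ∘ lift − Hd` (Tok-182 ×2 + window transport), clauses from Tok-cmpU-cap on both members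
    have htr : ∀ b' : PBond (F.P K) 0, recordHrLocξ F (thetaFill F a₀ ε₂₉) k (K + 1) (recordWindow F k (K + 1) (recordRNat F Mc k K / 2 - 1) (-z)) a (recordE F k (K + 1) μ z) (liftBondCtr F K 0 b') =
        recordHrLocξ F (thetaFill F a₀ ε₂₉) k K (recordWindow F k K (recordRNat F Mc k K / 2 - 1) (-z)) a (recordE F k K μ z) b' := fun b' => by
      funext i i'; exact recordHrLocξ_liftBondCtr F (thetaFill F a₀ ε₂₉) hk hnw a (recordE F k K μ z) (recordE F k (K + 1) μ z) hl1 hl2 b'.src b'.dir i i'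
    have hE : ∀ b' : PBond (F.P K) 0, recordHr F (thetaFill F a₀ ε₂₉) k (K + 1) a (recordE F k (K + 1) μ z) (liftBondCtr F K 0 b') - recordHr F (thetaFill F a₀ ε₂₉) k K a (recordE F k K μ z) b' =
        (recordHrLocξ F (thetaFill F a₀ ε₂₉) k (K + 1) Finset.univ a (recordE F k (K + 1) μ z) (liftBondCtr F K 0 b') -
            recordHrLocξ F (thetaFill F a₀ ε₂₉) k (K + 1) (recordWindow F k (K + 1) (recordRNat F Mc k K / 2 - 1) (-z)) a (recordE F k (K + 1) μ z) (liftBondCtr F K 0 b')) -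
          (recordHrLocξ F (thetaFill F a₀ ε₂₉) k K Finset.univ a (recordE F k K μ z) b' - recordHrLocξ F (thetaFill F a₀ ε₂₉) k K (recordWindow F k K (recordRNat F Mc k K / 2 - 1) (-z)) a (recordE F k K μ z) b') := by
      intro b'; rw [h182, h182', htr]; abel
    have hyw : (recordE F k K μ z).2 ∈ recordWindow F k K (recordRNat F Mc k K / 4 - 2 * Mc) (-z) := recordE_snd_mem_recordWindow F k K (recordRNat F Mc k K / 4 - 2 * Mc) μ z
    have hyw' : (recordE F k (K + 1) μ z).2 ∈ recordWindow F k (K + 1) (recordRNat F Mc k K / 4 - 2 * Mc) (-z) := recordE_snd_mem_recordWindow F k (K + 1) (recordRNat F Mc k K / 4 - 2 * Mc) μ z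
    have hR3R0 : (((recordRNat F Mc k K / 4 - 2 * Mc : ℕ)) : ℤ) ≤ (((recordRNat F Mc k K / 2 - 1 : ℕ)) : ℤ) := by exact_mod_cast (le_trans (Nat.le_add_right _ _) hR30)
    have hcR3 : ∀ i, 2 * (|(-z) i| + ((recordRNat F Mc k K / 4 - 2 * Mc) : ℕ)) < ((F.P K).sitesPerDir (k + 1) : ℤ) := fun i => by
      have := NoWrapAt.two_mul_lt F hnw (Nat.le_succ (recordRNat F Mc k K / 2 - 1)) i
      linarith
    have hnear' : coarsenTo (k + 1) (liftBondCtr F K 0 β).src ∈ recordWindow F k (K + 1) (recordRNat F Mc k K / 4 - 2 * Mc) (-z) := by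
      rw [hcoarse, liftSiteCtr_mem_recordWindow_iff F k K (recordRNat F Mc k K / 4 - 2 * Mc) hk (-z) hcR3]; exact hnear
    have hA := hcmp' (recordRNat F Mc k K / 4 - 2 * Mc) (recordRNat F Mc k K / 2 - 1) hR30 hcap' (-z) hyw' (liftBondCtr F K 0 β) hnear'
    have hB := hcmp (recordRNat F Mc k K / 4 - 2 * Mc) (recordRNat F Mc k K / 2 - 1) hR30 hcap (-z) hyw β hnear
    rw [heta] at hA
    have key := clauses_sub_lift F
      (fun b' => recordHrLocξ F (thetaFill F a₀ ε₂₉) k (K + 1) Finset.univ a (recordE F k (K + 1) μ z) b' - recordHrLocξ F (thetaFill F a₀ ε₂₉) k (K + 1) (recordWindow F k (K + 1) (recordRNat F Mc k K / 2 - 1) (-z)) a (recordE F k (K + 1) μ z) b')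
      (fun b' => recordHrLocξ F (thetaFill F a₀ ε₂₉) k K Finset.univ a (recordE F k K μ z) b' - recordHrLocξ F (thetaFill F a₀ ε₂₉) k K (recordWindow F k K (recordRNat F Mc k K / 2 - 1) (-z)) a (recordE F k K μ z) b')
      β.src β.dir hsh hun hus hA.1 hA.2.1 hA.2.2.1 hA.2.2.2 hB.1 hB.2.1 hB.2.2.1 hB.2.2.2
    simp only [hE]
    -- the exponential bookkeeping: `t ≤ 4R3 ≤ ρ`, `R0 − R3 ≥ ρ/4 − 2`
    have ht4 : (Site.tdist (coarsenTo (k + 1) β.src) (recordE F k K μ z).2 : ℝ) ≤ (recordRNat F Mc k K : ℝ) := by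
      have h1 := tdist_le_of_mem_window F (z₀ := -z) hnear
      rw [← hy2] at h1
      have h1c : (Site.tdist (coarsenTo (k + 1) β.src) (recordE F k K μ z).2 : ℝ) ≤ ((4 * (recordRNat F Mc k K / 4 - 2 * Mc) : ℕ) : ℝ) := by exact_mod_cast h1
      have h2 : ((4 * (recordRNat F Mc k K / 4 - 2 * Mc) : ℕ) : ℝ) ≤ (recordRNat F Mc k K : ℝ) := by exact_mod_cast h4R3
      linarith
    have hexp := exp_near_le (δ := δ₉) hδ.le hMc0 ht4 hdiff
    have hexp' : C * Real.exp (-(δ₉ * ((((recordRNat F Mc k K / 2 - 1) : ℕ) : ℝ) - (((recordRNat F Mc k K / 4 - 2 * Mc) : ℕ) : ℝ)))) + C * Real.exp (-(δ₉ * ((((recordRNat F Mc k K / 2 - 1) : ℕ) : ℝ) - (((recordRNat F Mc k K / 4 - 2 * Mc) : ℕ) : ℝ)))) ≤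
        2 * C * Real.exp (δ₉ * (2 * Mc + 2)) * Real.exp (-(δ₉ / 8) * (recordRNat F Mc k K : ℝ)) * Real.exp (-(δ₉ / 8 * (Site.tdist (coarsenTo (k + 1) β.src) (recordE F k K μ z).2 : ℝ))) := by
      have := mul_le_mul_of_nonneg_left hexp hC
      linarith
    obtain ⟨k1, k2, k3, k4⟩ := key
    refine ⟨k1.trans ?_, fun ν => (k2 ν).trans ?_, k3.trans ?_, k4.trans ?_⟩
    · have := mul_le_mul_of_nonneg_left hexp' hη0.le; linarith
    · have := mul_le_mul_of_nonneg_left hexp' hη2.le; linarith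
    · have := mul_le_mul_of_nonneg_left hexp' hη3.le; linarith
    · have := mul_le_mul_of_nonneg_left hexp' hη3.le; linarith
  · -- FAR: ‴ on both members; the lifted bond is at least as far from the lifted label
    have hA := h3' (liftBondCtr F K 0 β)
    have hB := h3 β
    rw [heta] at hA
    have htR : (recordRNat F Mc k K : ℝ) / 4 - 2 * Mc - 1 ≤ (Site.tdist (coarsenTo (k + 1) β.src) (recordE F k K μ z).2 : ℝ) := by
      have h1 := succ_le_tdist_of_not_mem_window F (z₀ := -z) hnear
      rw [← hy2] at h1
      have h1c : ((((recordRNat F Mc k K / 4 - 2 * Mc) + 1 : ℕ)) : ℝ) ≤ (Site.tdist (coarsenTo (k + 1) β.src) (recordE F k K μ z).2 : ℝ) := by exact_mod_cast h1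
      push_cast at h1c
      linarith
    have hexpB := exp_far_le (δ := δ₉) hδ.le hMc0 hρ0 htR
    have hexpA : Real.exp (-(δ₉ * (Site.tdist (coarsenTo (k + 1) (liftBondCtr F K 0 β).src) (recordE F k (K + 1) μ z).2 : ℝ))) ≤
        Real.exp (δ₉ * (2 * Mc + 2)) * Real.exp (-(δ₉ / 8) * (recordRNat F Mc k K : ℝ)) * Real.exp (-(δ₉ / 8 * (Site.tdist (coarsenTo (k + 1) β.src) (recordE F k K μ z).2 : ℝ))) := by
      refine le_trans (Real.exp_le_exp.2 ?_) hexpB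
      have := mul_le_mul_of_nonneg_left htt hδ.le
      linarith
    have key := clauses_sub_lift F (recordHr F (thetaFill F a₀ ε₂₉) k (K + 1) a (recordE F k (K + 1) μ z)) (recordHr F (thetaFill F a₀ ε₂₉) k K a (recordE F k K μ z)) β.src β.dir hsh hun hus
      hA.1 hA.2.1 hA.2.2.1 hA.2.2.2 hB.1 hB.2.1 hB.2.2.1 hB.2.2.2
    have hsum : C * Real.exp (-(δ₉ * (Site.tdist (coarsenTo (k + 1) (liftBondCtr F K 0 β).src) (recordE F k (K + 1) μ z).2 : ℝ))) + C * Real.exp (-(δ₉ * (Site.tdist (coarsenTo (k + 1) β.src) (recordE F k K μ z).2 : ℝ))) ≤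
        2 * C * Real.exp (δ₉ * (2 * Mc + 2)) * Real.exp (-(δ₉ / 8) * (recordRNat F Mc k K : ℝ)) * Real.exp (-(δ₉ / 8 * (Site.tdist (coarsenTo (k + 1) β.src) (recordE F k K μ z).2 : ℝ))) := by
      have h1 := mul_le_mul_of_nonneg_left hexpA hC
      have h2 := mul_le_mul_of_nonneg_left hexpB hC
      linarith
    obtain ⟨k1, k2, k3, k4⟩ := key
    refine ⟨k1.trans ?_, fun ν => (k2 ν).trans ?_, k3.trans ?_, k4.trans ?_⟩
    · have := mul_le_mul_of_nonneg_left hsum hη0.le; linarith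
    · have := mul_le_mul_of_nonneg_left hsum hη2.le; linarith
    · have := mul_le_mul_of_nonneg_left hsum hη3.le; linarith
    · have := mul_le_mul_of_nonneg_left hsum hη3.le; linarith


/-! ## §3  ★★★ The GLOBAL two-volume row (R4ᴰ) for the L-data by the sandwich -/

/-- ★★★ **ROW (R4ᴰ) FOR THE GLOBAL L-DATA `recordGkL` BY THE SANDWICH** (one member `K`, one off-wrap domain `X`, one N-slot label): under TokP9reg at both members, the ‴-clauses at both members,
Tok-182 at both members and Tok-cmpU-cap at both members (the DISPLAYED tokens of v11-G₄), the gauge of the cut two-volume difference is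
`≤ C₄ · e^{−(δ₉∕4)·ρ∕2} · e^{−((δ₉∕4)∕2)·dist(y, X)}` with `C₄ = 2C·e^{δ₉(2Mc+2)}·2(3 + 2‖π_ℝ‖)e^{(δ₉∕2)Mc}∕α₂` (`C > 0`).
[cite: Balaban1987RG1, (1.21) p.264, (4.4)–(4.5) pp.281–282, p.290 L17–20, (4.35) p.290; Balaban1985Variational, (182) p.307, (190) p.308, Prop. 9 p.309] -/
theorem rowR4D_L_sandwich (ha₀ : 0 < a₀) (hMc : McGuard F Mc) (hK : recordK₀ F Mc k ≤ K) (a : (thetaFill F a₀ ε₂₉).ιβ) (μ : Fin 4) (z : Fin 4 → ℤ)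
    (hz : ∀ l, 2 * |z l| < (recordRNat F Mc k K : ℤ)) {X : (recordDomSys F Mc k K).Dom} (hX : X ∉ recordWrapCtr F Mc k K)
    {C δ₉ : ℝ} (hC : 0 < C) (hδ : 0 < δ₉)
    (h3 : letI Hr := recordHr F (thetaFill F a₀ ε₂₉) k K a (recordE F k K μ z);
      ∀ b : PBond (F.P K) 0,
        ‖Hr b‖ ≤ C * (F.P K).eta (k + 1) * Real.exp (-(δ₉ * (Site.tdist (coarsenTo (k + 1) b.src) (recordE F k K μ z).2 : ℝ))) ∧
        (∀ ν : Fin (F.P K).d, ‖Hr ⟨b.src.shift ν, b.dir⟩ - Hr b‖ ≤ C * (F.P K).eta (k + 1) ^ 2 * Real.exp (-(δ₉ * (Site.tdist (coarsenTo (k + 1) b.src) (recordE F k K μ z).2 : ℝ)))) ∧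
        ‖∑ ν : Fin (F.P K).d, (Hr ⟨b.src.shift ν, b.dir⟩ - (2 : ℂ) • Hr b + Hr ⟨b.src.unshift ν, b.dir⟩)‖ ≤
          C * (F.P K).eta (k + 1) ^ 3 * Real.exp (-(δ₉ * (Site.tdist (coarsenTo (k + 1) b.src) (recordE F k K μ z).2 : ℝ))) ∧
        ‖∑ ν : Fin (F.P K).d, ((Hr ⟨b.src, b.dir⟩ + Hr ⟨(b.src).shift b.dir, ν⟩ - Hr ⟨(b.src).shift ν, b.dir⟩ - Hr ⟨b.src, ν⟩) -
          (Hr ⟨b.src.unshift ν, b.dir⟩ + Hr ⟨(b.src.unshift ν).shift b.dir, ν⟩ - Hr ⟨(b.src.unshift ν).shift ν, b.dir⟩ - Hr ⟨b.src.unshift ν, ν⟩))‖ ≤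
          C * (F.P K).eta (k + 1) ^ 3 * Real.exp (-(δ₉ * (Site.tdist (coarsenTo (k + 1) b.src) (recordE F k K μ z).2 : ℝ))))
    (h3' : letI Hr := recordHr F (thetaFill F a₀ ε₂₉) k (K + 1) a (recordE F k (K + 1) μ z);
      ∀ b : PBond (F.P (K + 1)) 0,
        ‖Hr b‖ ≤ C * (F.P (K + 1)).eta (k + 1) * Real.exp (-(δ₉ * (Site.tdist (coarsenTo (k + 1) b.src) (recordE F k (K + 1) μ z).2 : ℝ))) ∧
        (∀ ν : Fin (F.P (K + 1)).d, ‖Hr ⟨b.src.shift ν, b.dir⟩ - Hr b‖ ≤ C * (F.P (K + 1)).eta (k + 1) ^ 2 * Real.exp (-(δ₉ * (Site.tdist (coarsenTo (k + 1) b.src) (recordE F k (K + 1) μ z).2 : ℝ)))) ∧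
        ‖∑ ν : Fin (F.P (K + 1)).d, (Hr ⟨b.src.shift ν, b.dir⟩ - (2 : ℂ) • Hr b + Hr ⟨b.src.unshift ν, b.dir⟩)‖ ≤
          C * (F.P (K + 1)).eta (k + 1) ^ 3 * Real.exp (-(δ₉ * (Site.tdist (coarsenTo (k + 1) b.src) (recordE F k (K + 1) μ z).2 : ℝ))) ∧
        ‖∑ ν : Fin (F.P (K + 1)).d, ((Hr ⟨b.src, b.dir⟩ + Hr ⟨(b.src).shift b.dir, ν⟩ - Hr ⟨(b.src).shift ν, b.dir⟩ - Hr ⟨b.src, ν⟩) -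
          (Hr ⟨b.src.unshift ν, b.dir⟩ + Hr ⟨(b.src.unshift ν).shift b.dir, ν⟩ - Hr ⟨(b.src.unshift ν).shift ν, b.dir⟩ - Hr ⟨b.src.unshift ν, ν⟩))‖ ≤
          C * (F.P (K + 1)).eta (k + 1) ^ 3 * Real.exp (-(δ₉ * (Site.tdist (coarsenTo (k + 1) b.src) (recordE F k (K + 1) μ z).2 : ℝ))))
    (h182 : ∀ b : PBond (F.P K) 0, recordHr F (thetaFill F a₀ ε₂₉) k K a (recordE F k K μ z) b = recordHrLocξ F (thetaFill F a₀ ε₂₉) k K Finset.univ a (recordE F k K μ z) b)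
    (h182' : ∀ b : PBond (F.P (K + 1)) 0, recordHr F (thetaFill F a₀ ε₂₉) k (K + 1) a (recordE F k (K + 1) μ z) b =
      recordHrLocξ F (thetaFill F a₀ ε₂₉) k (K + 1) Finset.univ a (recordE F k (K + 1) μ z) b)
    (hcmp : ∀ R3 R0 : ℕ, R3 + nestRadius Mc 1 ≤ R0 → 2 * (R0 + 1) < (F.P K).sitesPerDir (k + 1) → ∀ z₀ : Fin 4 → ℤ, (recordE F k K μ z).2 ∈ recordWindow F k K R3 z₀ →
      letI Hd : PBond (F.P K) 0 → Fin 2 → Fin 2 → ℂ := fun b' => recordHrLocξ F (thetaFill F a₀ ε₂₉) k K Finset.univ a (recordE F k K μ z) b' -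
        recordHrLocξ F (thetaFill F a₀ ε₂₉) k K (recordWindow F k K R0 z₀) a (recordE F k K μ z) b';
      ∀ b : PBond (F.P K) 0, coarsenTo (k + 1) b.src ∈ recordWindow F k K R3 z₀ →
        ‖Hd b‖ ≤ C * (F.P K).eta (k + 1) * Real.exp (-(δ₉ * ((R0 : ℝ) - (R3 : ℝ)))) ∧
        (∀ ν : Fin (F.P K).d, ‖Hd ⟨b.src.shift ν, b.dir⟩ - Hd b‖ ≤ C * (F.P K).eta (k + 1) ^ 2 * Real.exp (-(δ₉ * ((R0 : ℝ) - (R3 : ℝ))))) ∧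
        ‖∑ ν : Fin (F.P K).d, (Hd ⟨b.src.shift ν, b.dir⟩ - (2 : ℂ) • Hd b + Hd ⟨b.src.unshift ν, b.dir⟩)‖ ≤ C * (F.P K).eta (k + 1) ^ 3 * Real.exp (-(δ₉ * ((R0 : ℝ) - (R3 : ℝ)))) ∧
        ‖∑ ν : Fin (F.P K).d, ((Hd ⟨b.src, b.dir⟩ + Hd ⟨(b.src).shift b.dir, ν⟩ - Hd ⟨(b.src).shift ν, b.dir⟩ - Hd ⟨b.src, ν⟩) -
          (Hd ⟨b.src.unshift ν, b.dir⟩ + Hd ⟨(b.src.unshift ν).shift b.dir, ν⟩ - Hd ⟨(b.src.unshift ν).shift ν, b.dir⟩ - Hd ⟨b.src.unshift ν, ν⟩))‖ ≤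
          C * (F.P K).eta (k + 1) ^ 3 * Real.exp (-(δ₉ * ((R0 : ℝ) - (R3 : ℝ)))))
    (hcmp' : ∀ R3 R0 : ℕ, R3 + nestRadius Mc 1 ≤ R0 → 2 * (R0 + 1) < (F.P (K + 1)).sitesPerDir (k + 1) → ∀ z₀ : Fin 4 → ℤ, (recordE F k (K + 1) μ z).2 ∈ recordWindow F k (K + 1) R3 z₀ →
      letI Hd : PBond (F.P (K + 1)) 0 → Fin 2 → Fin 2 → ℂ := fun b' => recordHrLocξ F (thetaFill F a₀ ε₂₉) k (K + 1) Finset.univ a (recordE F k (K + 1) μ z) b' -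
        recordHrLocξ F (thetaFill F a₀ ε₂₉) k (K + 1) (recordWindow F k (K + 1) R0 z₀) a (recordE F k (K + 1) μ z) b';
      ∀ b : PBond (F.P (K + 1)) 0, coarsenTo (k + 1) b.src ∈ recordWindow F k (K + 1) R3 z₀ →
        ‖Hd b‖ ≤ C * (F.P (K + 1)).eta (k + 1) * Real.exp (-(δ₉ * ((R0 : ℝ) - (R3 : ℝ)))) ∧
        (∀ ν : Fin (F.P (K + 1)).d, ‖Hd ⟨b.src.shift ν, b.dir⟩ - Hd b‖ ≤ C * (F.P (K + 1)).eta (k + 1) ^ 2 * Real.exp (-(δ₉ * ((R0 : ℝ) - (R3 : ℝ))))) ∧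
        ‖∑ ν : Fin (F.P (K + 1)).d, (Hd ⟨b.src.shift ν, b.dir⟩ - (2 : ℂ) • Hd b + Hd ⟨b.src.unshift ν, b.dir⟩)‖ ≤ C * (F.P (K + 1)).eta (k + 1) ^ 3 * Real.exp (-(δ₉ * ((R0 : ℝ) - (R3 : ℝ)))) ∧
        ‖∑ ν : Fin (F.P (K + 1)).d, ((Hd ⟨b.src, b.dir⟩ + Hd ⟨(b.src).shift b.dir, ν⟩ - Hd ⟨(b.src).shift ν, b.dir⟩ - Hd ⟨b.src, ν⟩) -
          (Hd ⟨b.src.unshift ν, b.dir⟩ + Hd ⟨(b.src.unshift ν).shift b.dir, ν⟩ - Hd ⟨(b.src.unshift ν).shift ν, b.dir⟩ - Hd ⟨b.src.unshift ν, ν⟩))‖ ≤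
          C * (F.P (K + 1)).eta (k + 1) ^ 3 * Real.exp (-(δ₉ * ((R0 : ℝ) - (R3 : ℝ)))))
    (hreg : letI θ := thetaFill F a₀ ε₂₉; letI := θ.instVβ₁; letI := θ.instVβ₂; letI := θ.instιβ;
      AnalyticAt ℝ (fun B : recordW F a₀ ε₂₉ k K => fun (b : PBond (F.P K) 0) (i i' : Fin 2) => ((recordBgField F θ k K B b : SU 2) : Matrix (Fin 2) (Fin 2) ℂ) i i') 0)
    (hreg' : letI θ := thetaFill F a₀ ε₂₉; letI := θ.instVβ₁; letI := θ.instVβ₂; letI := θ.instιβ;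
      AnalyticAt ℝ (fun B : recordW F a₀ ε₂₉ k (K + 1) => fun (b : PBond (F.P (K + 1)) 0) (i i' : Fin 2) => ((recordBgField F θ k (K + 1) B b : SU 2) : Matrix (Fin 2) (Fin 2) ℂ) i i') 0)
    {α₂ : ℝ} (hα : 0 < α₂) :
    gauge (recordDom44J F Mc k K X α₂) (B12FormatPlus.cutTo (recordCXJ F Mc k K X) fun i =>
        recordGkL F (thetaFill F a₀ ε₂₉) k (K + 1) a (recordE F k (K + 1) μ z) (recordJXJ F K i) - recordGkL F (thetaFill F a₀ ε₂₉) k K a (recordE F k K μ z) i) ≤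
      (2 * C * Real.exp (δ₉ * (2 * Mc + 2)) * (2 * (2 * 1 + 2 * ‖LinearMap.toContinuousLinearMap (sl2Proj.restrictScalars ℝ)‖ + 1) * Real.exp (4 * (δ₉ / 8) * Mc) / α₂)) *
        Real.exp (-(δ₉ / 4) * (recordRNat F Mc k K : ℝ) / 2) * Real.exp (-((δ₉ / 4) / 2) * (recordSiteGeom F Mc k K).distD (recordE F k K μ z) X) := by
  classical
  have hk : k + 1 ≤ F.m + K := by unfold recordK₀ at hK; omega
  have hkK : k + 1 ≤ (F.P K).m + (F.P K).K := by simpa using hk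
  have hkK' : k + 1 ≤ (F.P (K + 1)).m + (F.P (K + 1)).K := by simp only [T4Family.P_m, T4Family.P_K]; omega
  have hη0 : 0 < (F.P K).eta (k + 1) := by unfold Params.eta; exact pow_pos (inv_pos.2 (F.P K).cast_L_pos) _
  have heta : (F.P (K + 1)).eta (k + 1) = (F.P K).eta (k + 1) := rfl
  set Ch : ℝ := 2 * C * Real.exp (δ₉ * (2 * Mc + 2)) * Real.exp (-(δ₉ / 8) * recordRNat F Mc k K) with hCh
  have hCh0 : 0 < Ch := by rw [hCh]; positivity
  -- the per-bond clauses for `E`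
  have hcl := fun (β : PBond (F.P K) 0) (hβ : β ∈ domBonds F Mc k K X) =>
    sandwich_clauses (F := F) a₀ ε₂₉ hMc hK a μ z hz hX hC.le hδ h3 h3' h182 h182' hcmp hcmp' hβ
  -- the difference vector, its `𝐔`-block and `𝐉`-block
  have hcut : B12FormatPlus.cutTo (recordCXJ F Mc k K X) (fun i => recordGkL F (thetaFill F a₀ ε₂₉) k (K + 1) a (recordE F k (K + 1) μ z) (recordJXJ F K i) -
        recordGkL F (thetaFill F a₀ ε₂₉) k K a (recordE F k K μ z) i) =
      (fun i => B12FormatPlus.cutTo (recordCXJ F Mc k (K + 1) (recordDomEmbCtr F Mc k K X)) (recordGkL F (thetaFill F a₀ ε₂₉) k (K + 1) a (recordE F k (K + 1) μ z)) (recordJXJ F K i)) -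
        B12FormatPlus.cutTo (recordCXJ F Mc k K X) (recordGkL F (thetaFill F a₀ ε₂₉) k K a (recordE F k K μ z)) := by
    rw [show (fun i => recordGkL F (thetaFill F a₀ ε₂₉) k (K + 1) a (recordE F k (K + 1) μ z) (recordJXJ F K i) - recordGkL F (thetaFill F a₀ ε₂₉) k K a (recordE F k K μ z) i) =
      (fun i => recordGkL F (thetaFill F a₀ ε₂₉) k (K + 1) a (recordE F k (K + 1) μ z) (recordJXJ F K i)) - recordGkL F (thetaFill F a₀ ε₂₉) k K a (recordE F k K μ z) from rfl,
      cutTo_sub, cutTo_comp_recordJXJ hMc hK hX]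
  have hU : ∀ b ∈ domBonds F Mc k K X, chartMatU F K (B12FormatPlus.cutTo (recordCXJ F Mc k K X) fun i =>
      recordGkL F (thetaFill F a₀ ε₂₉) k (K + 1) a (recordE F k (K + 1) μ z) (recordJXJ F K i) - recordGkL F (thetaFill F a₀ ε₂₉) k K a (recordE F k K μ z) i) b =
      Matrix.of ((fun b' : PBond (F.P K) 0 => recordHr F (thetaFill F a₀ ε₂₉) k (K + 1) a (recordE F k (K + 1) μ z) (liftBondCtr F K 0 b') -
        recordHr F (thetaFill F a₀ ε₂₉) k K a (recordE F k K μ z) b') b) := by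
    intro b hb
    have hb' : liftBondCtr F K 0 b ∈ domBonds F Mc k (K + 1) (recordDomEmbCtr F Mc k K X) := (liftBondCtr_mem_domBonds_iff hMc hK X hX b).2 hb
    rw [hcut, chartMatU_sub, chartMatU_comp_recordJXJ, chartMatU_cutTo_recordGkL F (thetaFill F a₀ ε₂₉) k (K + 1) hkK' ha₀ a (recordE F k (K + 1) μ z) _ _, if_pos hb',
      chartMatU_cutTo_recordGkL F (thetaFill F a₀ ε₂₉) k K hkK ha₀ a (recordE F k K μ z) _ _, if_pos hb]
    ext i i'; simp
  -- the `𝐉`-block: `ξ⁻³·(−i)·π(e (d*d E))`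
  obtain ⟨e, he⟩ := exists_ofCLM
  have hJ : ∀ b ∈ domBonds F Mc k K X, ‖chartMatJc F K (B12FormatPlus.cutTo (recordCXJ F Mc k K X) fun i =>
      recordGkL F (thetaFill F a₀ ε₂₉) k (K + 1) a (recordE F k (K + 1) μ z) (recordJXJ F K i) - recordGkL F (thetaFill F a₀ ε₂₉) k K a (recordE F k K μ z) i) b‖ ≤
      Ch * (2 * ‖LinearMap.toContinuousLinearMap (sl2Proj.restrictScalars ℝ)‖) * Real.exp (-((δ₉ / 8) * (Site.tdist (coarsenTo (k + 1) b.src) (recordE F k K μ z).2 : ℝ))) := by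
    intro b hb
    have hb' : liftBondCtr F K 0 b ∈ domBonds F Mc k (K + 1) (recordDomEmbCtr F Mc k K X) := (liftBondCtr_mem_domBonds_iff hMc hK X hX b).2 hb
    obtain ⟨hsh, hun, hus⟩ := stencil_commute_of_mem_domBonds hMc hK hX hb
    rw [hcut, chartMatJc_sub, chartMatJc_comp_recordJXJ, chartMatJc_cutTo_recordGkL_eq_curl F a₀ ε₂₉ ha₀ k (K + 1) hkK' hreg' a (recordE F k (K + 1) μ z) _ _ hb',
      chartMatJc_cutTo_recordGkL_eq_curl F a₀ ε₂₉ ha₀ k K hkK hreg a (recordE F k K μ z) _ _ hb, heta, ← smul_sub, ← smul_sub, ← map_sub]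
    refine (norm_current_lin_le sl2Proj hη0 _).trans ?_
    have h4 := (hcl b hb).2.2.2
    have h2 := (norm_of_le_two_mul_norm _).trans (mul_le_mul_of_nonneg_left h4 zero_le_two)
    have hπ0 : 0 ≤ (((F.P K).eta (k + 1))⁻¹) ^ 3 * ‖LinearMap.toContinuousLinearMap (sl2Proj.restrictScalars ℝ)‖ := by positivity
    refine le_trans (le_of_eq ?_) ((mul_le_mul_of_nonneg_left h2 hπ0).trans (le_of_eq ?_))
    · -- the matrix identity: (K+1)-stencil at the lifted bond − K-stencil = `Matrix.of` of the stencil of `E`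
      congr 2
      change (∑ ν : Fin (F.P K).d, _) - _ = _
      rw [← Finset.sum_sub_distrib]
      ext i i'
      simp only [Matrix.sum_apply, Matrix.sub_apply, Matrix.add_apply, Matrix.of_apply, Finset.sum_apply, Pi.sub_apply, Pi.add_apply, liftBondCtr,
        hsh, hun, hus]
      exact Finset.sum_congr rfl fun ν _ => by ring
    · have hη3 : ((F.P K).eta (k + 1))⁻¹ ^ 3 * (F.P K).eta (k + 1) ^ 3 = 1 := by field_simp
      linear_combination (2 * ‖LinearMap.toContinuousLinearMap (sl2Proj.restrictScalars ℝ)‖ * Ch *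
        Real.exp (-(δ₉ / 8 * (Site.tdist (coarsenTo (k + 1) b.src) (recordE F k K μ z).2 : ℝ)))) * hη3
  -- the homogeneous generic row
  have hrow := gauge_recordDom44J_cutTo_le_of_entryDecayOn_homog (F := F) hMc hK X (recordE F k K μ z)
    (fun i => recordGkL F (thetaFill F a₀ ε₂₉) k (K + 1) a (recordE F k (K + 1) μ z) (recordJXJ F K i) - recordGkL F (thetaFill F a₀ ε₂₉) k K a (recordE F k K μ z) i)
    (fun b' : PBond (F.P K) 0 => recordHr F (thetaFill F a₀ ε₂₉) k (K + 1) a (recordE F k (K + 1) μ z) (liftBondCtr F K 0 b') - recordHr F (thetaFill F a₀ ε₂₉) k K a (recordE F k K μ z) b')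
    hα hCh0 (P := 2 * ‖LinearMap.toContinuousLinearMap (sl2Proj.restrictScalars ℝ)‖) (δ₉ := δ₉ / 8) (by positivity) (by positivity) hU
    (fun b hb => ⟨(hcl b hb).1, fun ν => (hcl b hb).2.1 ν, (hcl b hb).2.2.1⟩) hJ
  refine hrow.trans (le_of_eq ?_)
  have hsplit : Real.exp (-(δ₉ / 8) * (recordRNat F Mc k K : ℝ)) = Real.exp (-(δ₉ / 4) * (recordRNat F Mc k K : ℝ) / 2) := by congr 1; ring
  have hsplit' : Real.exp (-(δ₉ / 8) * (recordSiteGeom F Mc k K).distD (recordE F k K μ z) X) =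
      Real.exp (-((δ₉ / 4) / 2) * (recordSiteGeom F Mc k K).distD (recordE F k K μ z) X) := by congr 1; ring
  rw [← hsplit, ← hsplit', hCh]
  ring

end Sandwich

end Summit.QuantumFields.YangMills.Theorems.PortU8

end
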